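import Literature.AlgebraicGeometry.Resolution.AlterationsNormalFormCentreFormalIdeal
import Literature.AlgebraicGeometry.Resolution.RegularFormalFibres
import HarnessLib

/-!
# De Jong's alteration theorem: [S1] of 4.27 (`DeJong1996NormalFormPairCentreFormalIdeal`) — discharge

Topic: `Literature/AlgebraicGeometry/Resolution`. Sibling proof file of
`AlterationsNormalFormCentreFormalIdeal.lean`, which proves the named fact [S1]
`DeJong1996NormalFormPairCentreFormalIdeal` (`AlterationsNormalFormBlowupFormal.lean`; de Jong
1996, 4.27, p. 75: "Since `E` is smooth, its ideal in the rings of (ii) is given by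
`(u, v, t₁, t₂)` after renumbering", with the dictionary of 3.5 between the components of
`Sing(X)` through a closed point `x` and the primes `𝔭_{ab} = (u, v, t_a, t_b)` of the formal
model `A ≅ 𝒪̂_{X,x}`) from the standard leaf `Matsumura1987_32_polynomial` (polynomial rings
over a field are G-rings). Its printed-proof architecture uses that leaf at exactly one place —
EGA IV₂ 7.8.3 (v) for the local ring `𝒪_{X,x}`: "`(𝒪̂_{X,x})_𝔓` is regular iff
`(𝒪_{X,x})_{𝔓 ∩ 𝒪}` is" — and for that the GEOMETRIC regularity of the formal fibres is not
needed: the formal fibres of the local rings of a scheme locally of finite type over a field are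
regular rings (Mizutani's argument, Matsumura proof of Thm. 32.6 without Thm. 32.5), and
Matsumura's Thm. 23.7 only needs a regular closed fibre. That is the theorem
`isRegularLocalRing_localization_adicCompletion_stalk_iff` of `RegularFormalFibres.lean`, so [S1]
is now a THEOREM of the tree:

* `DeJong1996NormalFormPairCentreFormalIdeal_holds : DeJong1996NormalFormPairCentreFormalIdeal`
  — the proof of `DeJong1996NormalFormPairCentreFormalIdeal.of_polynomial_aux` verbatim, with
  `IsGRing.isRegularLocalRing_localization_adicCompletion_iff` (the leaf) replaced by
  `isRegularLocalRing_localization_adicCompletion_stalk_iff` (proved), and the algebra of the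
  formal model from `NodalFamilyRingSingularLocus.lean`;
* hence [S3] at the closed points over the centre from the formal chart computation alone
  (`DeJong1996NormalFormPairBlowupSingularOverCentre.of_nodalBlowup`).

## Sources

* A. J. de Jong, *Smoothness, semi-stability and alterations*, Publ. Math. IHÉS 83 (1996) 51–93:
  3.5 (p. 64), 4.25–4.27 (pp. 75–76). [DeJong1996]
* H. Matsumura, *Commutative Ring Theory* (1986): Thm. 8.11, Thm. 8.14, Thm. 14.3, Thm. 23.7,
  §32 p. 260 (proof of Thm. 32.6, Remark 1). [Matsumura1987]
* A. Grothendieck, EGA IV₂, Scholie 7.8.3 (v) — through `RegularFormalFibres.lean`.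
-/

noncomputable section

open CategoryTheory CategoryTheory.Limits AlgebraicGeometry TopologicalSpace Topology

namespace Literature.AlgebraicGeometry.Resolution

universe u

open IsLocalRing Scheme.IdealSheafData

open DeJong1996 in
/-- DISCHARGE of the named fact [S1] `DeJong1996NormalFormPairCentreFormalIdeal`
(`AlterationsNormalFormBlowupFormal.lean`) — **de Jong 1996, 4.27: "Since `E` is smooth, its
ideal in the rings of (ii) is given by `(u, v, t₁, t₂)` after renumbering", with the dictionary
of 3.5.** For a closed point `x ∈ Ē ⊆ Sing(X)` of a pair in Situation 4.25 and the isomorphism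
`e : 𝒪̂_{X,x} ≅ A = k⟦u, v, t⟧/(uv - t₁ ⋯ t_s)` of 4.25 (ii): (α) for a component `E' ∋ x` of
`Sing(X)`, `Î_{E'}` is prime (the completion of the regular `𝒪_{E',x}` is a domain) and
`V(Î_{E'}) ⊆ Sing(Spec 𝒪̂)` (descent of regularity to the non-regular points of `E'`), so
`e(Î_{E'}) ⊇ 𝔭_{ab}` for some `a < b ≤ s` (`Sing(A) ⊆ ⋃ V(𝔭_{ab})`); (β) every `𝔭_{ab}`
arises: `e⁻¹𝔭_{ab}` is a non-regular prime of `𝒪̂`, hence — the formal fibres of `𝒪_{X,x}`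
being regular (`isRegularLocalRing_localization_adicCompletion_stalk_iff`, EGA IV₂ 7.8.3 (v)) —
contracts to a non-regular point of `X` generising `x`, on a component `E'' ∋ x` with
`𝔭_{a'b'} ⊆ e(Î_{E''}) ⊆ 𝔭_{ab}`, forcing `(a', b') = (a, b)`; (γ) faithful flatness of the
completion and the generic point of `E'` turn `e(Î_{E''}) = 𝔭_{ab} ⊆ e(Î_{E'})` into
`E' = E''`. (The proof of `DeJong1996NormalFormPairCentreFormalIdeal.of_polynomial_aux` with the
G-ring leaf replaced by the theorem.) [cite: DeJong1996, 4.27, p. 75; 3.5, p. 64] -/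
theorem DeJong1996NormalFormPairCentreFormalIdeal_holds :
    DeJong1996NormalFormPairCentreFormalIdeal.{u} := by
  intro k _ _ X f Z d h E hE x hxc hx
  -- the algebra of the formal model (`NodalFamilyRingSingularLocus.lean`)
  have hSing₁ : ∀ (m s : ℕ), 2 ≤ s → s ≤ m →
      ∀ (𝔮 : Ideal (NodalFamilyRing k m s)) [𝔮.IsPrime],
        ¬ IsRegularLocalRing (Localization.AtPrime 𝔮) →
          ∃ a b : Fin m, a < b ∧ b.val < s ∧ nodalCentreIdeal k m s a b ≤ 𝔮 :=
    fun m s hs hsm 𝔮 _ h𝔮 =>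
      DeJong1996.exists_nodalCentreIdeal_le_of_not_isRegularLocalRing k m s hs hsm 𝔮 h𝔮
  have hSing₂ : ∀ (m s : ℕ), s ≤ m → ∀ {a b : Fin m}, a ≠ b → a.val < s → b.val < s →
      ∀ (𝔮 : Ideal (NodalFamilyRing k m s)) [𝔮.IsPrime],
        nodalCentreIdeal k m s a b ≤ 𝔮 → ¬ IsRegularLocalRing (Localization.AtPrime 𝔮) :=
    fun m s hsm _ _ hab ha hb 𝔮 _ hle =>
      DeJong1996.not_isRegularLocalRing_of_nodalCentreIdeal_le k m s hsm hab ha hb 𝔮 hle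
  have hinj : ∀ (m s : ℕ) {a b a' b' : Fin m}, a < b → b.val < s → a' < b' → b'.val < s →
      nodalCentreIdeal k m s a b ≤ nodalCentreIdeal k m s a' b' → a = a' ∧ b = b' :=
    fun m s _ _ _ _ hab hb hab' hb' hle => DeJong1996.eq_of_nodalCentreIdeal_le k m s hab hb hab' hb' hle
  have hprime : ∀ (m s : ℕ) {a b : Fin m}, a ≠ b → a.val < s → b.val < s →
      (nodalCentreIdeal k m s a b).IsPrime :=
    fun m s _ _ hab ha hb => DeJong1996.isPrime_nodalCentreIdeal k m s hab ha hb
  -- the singular locus and the centre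
  let S : Set X := {x : X | ¬ IsRegularLocalRing (X.presheaf.stalk x)}
  have hS : IsClosed S := h.isClosed_setOf_not_isRegularLocalRing
  haveI := h.isIntegral
  haveI := h.locallyOfFiniteType
  haveI : IsNoetherian X := h.isNoetherian
  have hĒeq : closure (Subtype.val '' E) = Subtype.val '' E := closure_image_val_eq hS hE
  have hĒmem : closure (Subtype.val '' E) ∈ componentsIn S := by
    rw [hĒeq]
    exact componentsIn.image_val_mem hE
  have hxS : ¬ IsRegularLocalRing (X.presheaf.stalk x) := componentsIn.subset hĒmem hx
  -- 4.25 (ii) at `x`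
  obtain ⟨s, r, hs2, hsr, hrd, e, hZ⟩ := h.exists_ringEquiv_of_not_isRegularLocalRing x hxc hxS
  refine ⟨s, r, hs2, hsr, hrd, e, hZ, ?_⟩
  -- notation
  let O := X.presheaf.stalk x
  let Ô := AdicCompletion (maximalIdeal O) O
  let c : O →+* Ô := algebraMap O Ô
  let Î : Closeds X → Ideal Ô := fun T => (stalkIdeal (vanishingIdeal T) x).map c
  have hÎU : ∀ (T : Closeds X) (U : X.affineOpens) (hU : x ∈ (U : X.Opens)),
      (completedStalkIdeal (vanishingIdeal T) x U hU).map e.toRingHom = (Î T).map e := by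
    intro T U hU
    rw [completedStalkIdeal_eq_map_stalkIdeal]
    rfl
  have hÎmono : ∀ {T T' : Closeds X}, T ≤ T' → Î T' ≤ Î T := fun hTT' =>
    Ideal.map_mono (stalkIdeal_mono (vanishingIdeal_antimono hTT') x)
  -- EGA IV₂ 7.8.3 (v) for `𝒪_{X,x}`: `Reg(Spec 𝒪̂) = Reg(Spec 𝒪)⁻¹` (regular formal fibres)
  have hReg : ∀ (𝔓 : Ideal Ô) [𝔓.IsPrime],
      IsRegularLocalRing (Localization.AtPrime 𝔓) ↔
        IsRegularLocalRing (Localization.AtPrime (𝔓.under O)) := fun 𝔓 _ =>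
    (isRegularLocalRing_localization_adicCompletion_stalk_iff f x 𝔓).1
  -- F4: `V(Î_S) ⊆ Sing(Ô)`
  have F4 : ∀ (𝔓 : Ideal Ô) [𝔓.IsPrime], Î ⟨S, hS⟩ ≤ 𝔓 →
      ¬ IsRegularLocalRing (Localization.AtPrime 𝔓) := by
    intro 𝔓 _ hle hreg
    have h1 : IsRegularLocalRing (Localization.AtPrime (𝔓.under O)) := (hReg 𝔓).mp hreg
    let 𝔮 : Spec O := ⟨𝔓.under O, inferInstance⟩
    have h2 := (isRegularLocalRing_localization_stalk_iff x 𝔮).mp h1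
    have h3 : X.fromSpecStalk x 𝔮 ∈ ((⟨S, hS⟩ : Closeds X) : Set X) := by
      refine (fromSpecStalk_mem_iff_stalkIdeal_vanishingIdeal_le x ⟨S, hS⟩ 𝔮).mpr ?_
      change _ ≤ Ideal.comap c 𝔓
      rw [← Ideal.map_le_iff_le_comap]
      exact hle
    exact h3 h2
  -- F5: `Ô ≅ A` on regularity of localisations
  have F5 : ∀ (𝔓 : Ideal Ô) [𝔓.IsPrime],
      IsRegularLocalRing (Localization.AtPrime 𝔓) ↔
        IsRegularLocalRing (Localization.AtPrime (𝔓.map e)) := fun 𝔓 _ =>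
    (isRegularLocalRing_localization_map_ringEquiv_iff e 𝔓).symm
  -- Step α: every component through `x` has a prime completed ideal containing some `𝔭_{ab}`
  have hm : s ≤ d - 1 := hsr.trans hrd
  have stepα : ∀ E' (hE' : E' ∈ componentsIn S), x ∈ E' →
      (Î ⟨E', componentsIn.isClosed hS hE'⟩).IsPrime ∧
        ∃ a b : Fin (d - 1), a < b ∧ b.val < s ∧
          nodalCentreIdeal k (d - 1) s a b ≤ (Î ⟨E', componentsIn.isClosed hS hE'⟩).map e := by
    intro E' hE' hxE'
    have hE'c := componentsIn.isClosed hS hE'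
    -- the reduced component is a regular scheme (4.25)
    obtain ⟨E'', hE'', hE''eq⟩ := id hE'
    have hE''eq : Subtype.val '' E'' = E' := hE''eq
    have hreg : Scheme.IsRegular (vanishingIdeal ⟨E', hE'c⟩).subscheme := by
      have hC : (⟨closure (Subtype.val '' E''), isClosed_closure⟩ : Closeds X) = ⟨E', hE'c⟩ :=
        Closeds.ext (by simp only [Closeds.coe_mk]; rw [hE''eq, hE'c.closure_eq])
      rw [← hC]
      exact h.isRegular_subscheme E'' hE''
    have hxsupp : x ∈ (vanishingIdeal ⟨E', hE'c⟩).support := by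
      rw [← SetLike.mem_coe, coe_support_vanishingIdeal]
      exact hxE'
    haveI hP : (Î ⟨E', hE'c⟩).IsPrime := isPrime_map_stalkIdeal_adicCompletion x hreg hxsupp
    refine ⟨hP, ?_⟩
    have hle : Î ⟨S, hS⟩ ≤ Î ⟨E', hE'c⟩ := hÎmono (componentsIn.subset ⟨E'', hE'', hE''eq⟩)
    have h1 := F4 (Î ⟨E', hE'c⟩) hle
    rw [F5] at h1
    exact hSing₁ (d - 1) s hs2 hm _ h1
  -- Step β: every `𝔭_{ab}` is the completed ideal of some component through `x`
  have stepβ : ∀ a b : Fin (d - 1), a < b → b.val < s →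
      ∃ E'' : Set X, ∃ hE'' : E'' ∈ componentsIn S, x ∈ E'' ∧
        (Î ⟨E'', componentsIn.isClosed hS hE''⟩).map e = nodalCentreIdeal k (d - 1) s a b := by
    intro a b hab hbs
    have has : a.val < s := lt_trans hab hbs
    haveI := hprime (d - 1) s hab.ne has hbs
    -- `𝔓 = e⁻¹ 𝔭_{ab}` is a non-regular prime of `Ô`
    let 𝔓 : Ideal Ô := (nodalCentreIdeal k (d - 1) s a b).comap e
    haveI : 𝔓.IsPrime := Ideal.comap_isPrime e _
    have h𝔓map : 𝔓.map e = nodalCentreIdeal k (d - 1) s a b :=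
      Ideal.map_comap_of_surjective e e.surjective _
    have h1 : ¬ IsRegularLocalRing (Localization.AtPrime 𝔓) := by
      rw [F5]
      exact hSing₂ (d - 1) s hm hab.ne has hbs (𝔓.map e) h𝔓map.ge
    -- so its contraction `𝔮` to `𝒪_{X,x}` is a non-regular point of `X` (EGA IV₂ 7.8.3 (v))
    let 𝔮 : Spec O := ⟨𝔓.under O, inferInstance⟩
    have h2 : ¬ IsRegularLocalRing (X.presheaf.stalk (X.fromSpecStalk x 𝔮)) := fun hreg =>
      h1 ((hReg 𝔓).mpr ((isRegularLocalRing_localization_stalk_iff x 𝔮).mpr hreg))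
    -- a component `E''` of `S` through that point, hence through `x`
    obtain ⟨E'', hE'', hqE''⟩ := componentsIn.exists_mem (S := S) h2
    have hE''c := componentsIn.isClosed hS hE''
    have hspec : X.fromSpecStalk x 𝔮 ⤳ x := Scheme.range_fromSpecStalk.le ⟨𝔮, rfl⟩
    have hxE'' : x ∈ E'' := hspec.mem_closed hE''c hqE''
    refine ⟨E'', hE'', hxE'', ?_⟩
    -- `Î_{E''} ≤ 𝔓`
    have h3 : Î ⟨E'', hE''c⟩ ≤ 𝔓 := by
      rw [Ideal.map_le_iff_le_comap]
      exact (fromSpecStalk_mem_iff_stalkIdeal_vanishingIdeal_le x ⟨E'', hE''c⟩ 𝔮).mp hqE''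
    -- `𝔭_{a'b'} ≤ Î_{E''} ε ≤ 𝔓 ε = 𝔭_{ab}` forces `(a', b') = (a, b)`
    obtain ⟨-, a', b', hab', hb's, h4⟩ := stepα E'' hE'' hxE''
    have h5 : (Î ⟨E'', hE''c⟩).map e ≤ nodalCentreIdeal k (d - 1) s a b :=
      h𝔓map ▸ Ideal.map_mono h3
    obtain ⟨rfl, rfl⟩ := hinj (d - 1) s hab' hb's hab hbs (h4.trans h5)
    exact le_antisymm h5 h4
  -- Step γ: the completed ideal of a component through `x` IS some `𝔭_{ab}`
  have stepγ : ∀ E' (hE' : E' ∈ componentsIn S), x ∈ E' →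
      ∃ a b : Fin (d - 1), a < b ∧ b.val < s ∧
        (Î ⟨E', componentsIn.isClosed hS hE'⟩).map e = nodalCentreIdeal k (d - 1) s a b := by
    intro E' hE' hxE'
    obtain ⟨-, a, b, hab, hbs, h1⟩ := stepα E' hE' hxE'
    obtain ⟨E'', hE'', hxE'', h2⟩ := stepβ a b hab hbs
    refine ⟨a, b, hab, hbs, ?_⟩
    -- `Î_{E''} ε = 𝔭 ≤ Î_{E'} ε`, so `I_{E''} ≤ I_{E'}`, so `E' = E''`
    have h3 : Î ⟨E'', componentsIn.isClosed hS hE''⟩ ≤ Î ⟨E', componentsIn.isClosed hS hE'⟩ := by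
      have := Ideal.comap_mono (f := e) (h2.le.trans h1)
      rwa [Ideal.comap_map_of_bijective e e.bijective,
        Ideal.comap_map_of_bijective e e.bijective] at this
    have h4 : stalkIdeal (vanishingIdeal ⟨E'', componentsIn.isClosed hS hE''⟩) x ≤
        stalkIdeal (vanishingIdeal ⟨E', componentsIn.isClosed hS hE'⟩) x := by
      have := Ideal.comap_mono (f := c) h3
      rwa [comap_map_stalk_adicCompletion, comap_map_stalk_adicCompletion] at this
    obtain rfl := eq_of_stalkIdeal_vanishingIdeal_le hS hE' hE'' hxE' h4
    exact h2
  -- Step δ: assemble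
  obtain ⟨a₀, b₀, hab₀, hb₀s, h₀⟩ := stepγ _ hĒmem hx
  refine ⟨a₀, b₀, hab₀, hb₀s, fun U hU => ?_, fun E' hE' hxE' => ?_, fun a b hab hbs => ?_⟩
  · rw [hÎU, ← h₀]
  · obtain ⟨a, b, hab, hbs, h1⟩ := stepγ E' hE' hxE'
    refine ⟨a, b, hab, hbs, fun U hU => ?_⟩
    have hC : (⟨closure E', isClosed_closure⟩ : Closeds X) = ⟨E', componentsIn.isClosed hS hE'⟩ :=
      Closeds.ext (componentsIn.isClosed hS hE').closure_eq
    rw [hÎU, hC, h1]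
  · obtain ⟨E'', hE'', hxE'', h1⟩ := stepβ a b hab hbs
    refine ⟨E'', hE'', hxE'', fun U hU => ?_⟩
    have hC : (⟨closure E'', isClosed_closure⟩ : Closeds X) =
        ⟨E'', componentsIn.isClosed hS hE''⟩ :=
      Closeds.ext (componentsIn.isClosed hS hE'').closure_eq
    rw [hÎU, hC, h1]

/-- Hence **[S3] at the closed points over the centre**
(`DeJong1996NormalFormPairBlowupSingularOverCentre`) from the formal chart computation
(`DeJong1996NodalBlowupSingularLocus`) ALONE. [cite: DeJong1996, 4.27, pp. 75–76] -/
theorem DeJong1996NormalFormPairBlowupSingularOverCentre.of_nodalBlowup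
    (H₂ : DeJong1996NodalBlowupSingularLocus.{u}) :
    DeJong1996NormalFormPairBlowupSingularOverCentre.{u} :=
  DeJong1996NormalFormPairBlowupSingularOverCentre.of_centreFormalIdeal_of_nodalBlowup
    DeJong1996NormalFormPairCentreFormalIdeal_holds H₂

end Literature.AlgebraicGeometry.Resolution

end
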